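/-
Copyright: statement-level skeleton of a published paper (lit-balaban cell, Phase-2 proof seat p19, gen 2). No claims beyond
what the kernel checks below.
-/
import Mathlib
import Literature.MathematicalPhysics.QuantumFieldTheory.Balaban1983to89.B3Ineq215Reroute

/-!
# B3 — T. Bałaban, *(Higgs)₂,₃ quantum fields in a finite volume. III. Renormalization*, CMP **88** (1983) 411–445
[Balaban1983Higgs3] — Sect. 2, pp. 427–428: the shrinking step (2.15′)/(2.16) of the proof of (2.15), PROVED

statement-level skeleton of published theorems with citation tags; proofs where landed; nothing here is a claim about
the Yang–Mills mass gap

PDF held: `paper:balaban1983-higgs-2-3-quantum-fields-finite-volume` (journal page = PDF page + 410); renders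
`pub-balaban/b2b-balaban-ref1/pages/1983-cmp88-higgs23-III/1983-cmp88-higgs23-III-p017, p018-x2.png` (pp. 427, 428).

WHAT IS REPRODUCED.  Part of the Phase-2 proof of SKELETON rows **B3.Eq2.15-2.16** (unit `lit-balaban-p19` gen 2, HOME `run/shared/lean/pub/lit-balaban/`): files `B3Ineq215CubeGeometry` → `B3Ineq215DecaySum`, `B3Ineq215Quotient` → `B3Ineq215Degrees` → `B3Ineq215Reroute` → `B3Ineq215Step` → `B3Ineq215Proof` (the theorem `Model.ineq215`), all in the sub-namespace `…Balaban1983to89.B3Ineq215`; the rows were typed by r15 in `B3Sect2FirstEstimate`.  The ONE-LINE shrinking step of p. 427–428, for a fixed scale assignment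
`j ∈ J(l̃)` (monotone along the ordering, `j_l ≤ k − 1`), stage `i` → `i+1` (shrinking the line l(i+1) of lowest index
`t = j_{l(i+1)}` among the lines of `G/G_i`), in Prop. 2.2 generality and on the concrete cubes of
`B3Ineq215CubeGeometry`: **`step216`**:
  (L^tη)^{Σ_α D(G_i^{(α)})} · Σ_{{Δ}} Ẽ_{δ_i}(G/G_i(j), {Δ}) ≤ e^{δ₀} K(δ_{i+1}, d) · (L^tη)^{Σ_α D(G_{i+1}^{(α)})} ·
  Σ_{{Δ}} Ẽ_{δ_{i+1}}(G/G_{i+1}(j), {Δ}).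
The proof follows the text: (i) *"We represent the exponential factor for the line l(1) as a product of as many equal
factors as there are legs in v′ … These factors combined with the exponential factors of the lines l′ give us the
factors exp[−δ₂(L^{j_{l′}}η)^{−1}dist(Δ(v), Δ(v″))]"* and (ii) the summation over Δ(v′) are in `B3Ineq215Reroute`
(`EXP_succ_le`, `sum_bt_le`); here: (iii) *"we fix a localization Δ(v₁) of the vertex v₁, |Δ(v₁)| = (L^{j(v₁)}η)^d, and we sum over
Δ(v) ⊂ Δ(v₁) using the factor (L^{j(v)}η)^d"* — `sum_regroup_le` (Fubini in the coordinate `b_s`, monotonicity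
`Cube.distI_anc_le`, count `Cube.sum_desc_anc`); (iv) *"the remaining powers of L^jη connected with the graph G₁ give us
(L^jη)^{D(G₁)}"* — `Model.Dsum_succ` + the scale algebra; *"In the case v = v′ we make the same operations beginning
with the summation over Δ(v)"* — the loop case `b_s = b_t` is treated uniformly (the decay factor of l(i+1) is then
`1`).  The summation over `j` and the assembly of (2.15) are in `B3Ineq215Proof`.
-/

open Finset

namespace Literature.MathematicalPhysics.QuantumFieldTheory.Balaban1983to89.B3Ineq215

namespace Model

variable {V : Type} [Fintype V] [DecidableEq V] {m : ℕ} (M : Model V m)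

section Step

variable {i : ℕ} (h : i < m) {j : Fin m → ℕ} {k : ℕ} (hj : Monotone j) (hjk : ∀ l, j l < k)

/-! ## (iii) The summation over `Δ(b_s) ⊂ Δ(v₁)` -/

/-- Replacing the cube of one vertex by an ancestor decreases no distance between localized vertices.
[cite: Balaban1983Higgs3, (2.16) p.428] -/
theorem distI_update_anc_le (Θ : V → Cube M.d) (b : V) {s' : ℕ} (hs : (Θ b).s ≤ s') (x y : V) :
    Cube.distI M.L (Function.update Θ b (Cube.anc M.L s' (Θ b)) x) (Function.update Θ b (Cube.anc M.L s' (Θ b)) y)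
      ≤ Cube.distI M.L (Θ x) (Θ y) := by
  by_cases hx : x = b <;> by_cases hy : y = b
  · subst hx; subst hy; simp [Cube.distI_self]
  · subst hx; rw [Function.update_self, Function.update_of_ne hy]; exact Cube.distI_anc_le M.L_pos hs _
  · subst hy; rw [Function.update_self, Function.update_of_ne hx]; exact Cube.distI_anc_le_right M.L_pos hs _
  · rw [Function.update_of_ne hx, Function.update_of_ne hy]

/-- … hence increases every exponential factor, so `EXP`. [cite: Balaban1983Higgs3, (2.16) p.428] -/
theorem EXP_update_anc_le (i' : ℕ) (j : Fin m → ℕ) (Θ : V → Cube M.d) (b : V) {s' : ℕ} (hs : (Θ b).s ≤ s') :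
    M.EXP i' j Θ ≤ M.EXP i' j (Function.update Θ b (Cube.anc M.L s' (Θ b))) := by
  refine Finset.prod_le_prod (fun l _ => (M.lineF_pos i' j Θ l).le) fun l _ => ?_
  unfold lineF
  refine Real.exp_le_exp.2 (neg_le_neg ?_)
  have hδ := M.δAt_pos i'
  have hL := M.L_pos_real
  refine div_le_div_of_nonneg_right (mul_le_mul_of_nonneg_left ?_ hδ.le) (by positivity)
  exact_mod_cast M.distI_update_anc_le Θ b hs _ _

/-- p. 427–428: *"we fix a localization Δ(v₁) of the vertex v₁, |Δ(v₁)| = (L^{j(v₁)}η)^d, and we sum over Δ(v) ⊂ Δ(v₁)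
using the factor (L^{j(v)}η)^d"* — regrouping the `b_s`-coordinate from scale `t` to a coarser scale `t′ ≤ k`: the sum of
`EXP` over the finer localizations is at most `(L^{t′−t})^d` times the sum over the coarser ones (each finer cube is
replaced by its ancestor, `Cube.distI_anc_le`, and each coarser cube has `(L^{t′−t})^d` descendants, `Cube.sum_desc_anc`).
[cite: Balaban1983Higgs3, (2.16) p.428] -/
theorem sum_regroup_le (i' : ℕ) (box : V → Fin M.d → ℕ) (G : V → Finset (Cube M.d)) (b : V) {t t' : ℕ}
    (hG : G b = Cube.desc M.L (M.unit k box b) t) (htt' : t ≤ t') (ht'k : t' ≤ k) :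
    ∑ w ∈ Fintype.piFinset G, M.EXP i' j w
      ≤ ((M.L : ℝ) ^ (t' - t)) ^ M.d *
        ∑ w ∈ Fintype.piFinset (Function.update G b (Cube.desc M.L (M.unit k box b) t')), M.EXP i' j w := by
  set G'' := Function.update G b {M.unit k box b} with hG''
  have hG''b : G'' b = {M.unit k box b} := by simp [hG'']
  have hG1 : G = Function.update G'' b (Cube.desc M.L (M.unit k box b) t) := by
    rw [hG'', Function.update_idem, ← hG, Function.update_eq_self]
  have hG2 : Function.update G b (Cube.desc M.L (M.unit k box b) t')
      = Function.update G'' b (Cube.desc M.L (M.unit k box b) t') := by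
    rw [hG'', Function.update_idem]
  rw [hG2, hG1, ← Literature.AlgebraicTopology.CellComplexes.CubicalTorus.sum_piFinset_update G'' b hG''b,
    ← Literature.AlgebraicTopology.CellComplexes.CubicalTorus.sum_piFinset_update G'' b hG''b, Finset.mul_sum]
  refine Finset.sum_le_sum fun w _ => ?_
  have hk : t' ≤ (M.unit k box b).s := ht'k
  -- replace each fine cube by its scale-t' ancestor, then count
  calc ∑ A ∈ Cube.desc M.L (M.unit k box b) t, M.EXP i' j (Function.update w b A)
      ≤ ∑ A ∈ Cube.desc M.L (M.unit k box b) t, M.EXP i' j (Function.update w b (Cube.anc M.L t' A)) := by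
        refine Finset.sum_le_sum fun A hA => ?_
        have hAs : A.s = t := Cube.s_of_mem_desc M.L_pos hA
        have := M.EXP_update_anc_le i' j (Function.update w b A) b (s' := t') (by rw [Function.update_self, hAs]; exact htt')
        rwa [Function.update_self, Function.update_idem] at this
    _ = ∑ A' ∈ Cube.desc M.L (M.unit k box b) t', ((M.L ^ (t' - t)) ^ M.d) • M.EXP i' j (Function.update w b A') :=
        Cube.sum_desc_anc M.L_pos htt' hk (fun A => M.EXP i' j (Function.update w b A))
    _ = ((M.L : ℝ) ^ (t' - t)) ^ M.d * ∑ A' ∈ Cube.desc M.L (M.unit k box b) t', M.EXP i' j (Function.update w b A') := by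
        rw [Finset.mul_sum]
        refine Finset.sum_congr rfl fun A' _ => ?_
        rw [nsmul_eq_mul]; push_cast; ring

/-- The localizations of `G/G_{i+1}` are those of `G/G_i` with `b_t` frozen at its unit cube and `b_s` re-localized at
its new scale `j_{i+1}(b_s)` (two different blocks). [cite: Balaban1983Higgs3, (2.16) p.428] -/
theorem locF_succ_of_ne (hne : M.bs i h ≠ M.bt i h) (box : V → Fin M.d → ℕ) :
    M.locF (i + 1) k j box = Function.update
      (Function.update (M.locF i k j box) (M.bt i h) {M.unit k box (M.bt i h)}) (M.bs i h)
      (Cube.desc M.L (M.unit k box (M.bs i h)) (M.low (i + 1) (M.bs i h) j k)) := by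
  funext v
  by_cases hvs : v = M.bs i h
  · subst hvs
    rw [Function.update_self]
    unfold locF; rw [if_pos (M.rep_succ_bs h)]
  rw [Function.update_of_ne hvs]
  by_cases hvt : v = M.bt i h
  · subst hvt
    rw [Function.update_self]
    unfold locF
    rw [if_neg (by rw [M.rep_succ_bt h]; exact hne)]
  rw [Function.update_of_ne hvt]
  unfold locF
  have hiff : M.rep (i + 1) v = v ↔ M.rep i v = v := by
    rw [← M.mem_reps, ← M.mem_reps, M.reps_succ_of_ne h hne, Finset.mem_erase]
    exact ⟨fun h' => h'.2, fun h' => ⟨hvt, h'⟩⟩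
  by_cases hv : M.rep i v = v
  · rw [if_pos (hiff.2 hv), if_pos hv, M.low_succ_of_ne h hvs hvt]
  · rw [if_neg (fun h' => hv (hiff.1 h')), if_neg hv]

/-- The same in the loop case: only `b_s` is re-localized. [cite: Balaban1983Higgs3, (2.16) p.428] -/
theorem locF_succ_of_loop (heq : M.bs i h = M.bt i h) (box : V → Fin M.d → ℕ) :
    M.locF (i + 1) k j box = Function.update (M.locF i k j box) (M.bs i h)
      (Cube.desc M.L (M.unit k box (M.bs i h)) (M.low (i + 1) (M.bs i h) j k)) := by
  funext v
  by_cases hvs : v = M.bs i h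
  · subst hvs
    rw [Function.update_self]
    unfold locF; rw [if_pos (M.rep_succ_bs h)]
  rw [Function.update_of_ne hvs]
  have hvt : v ≠ M.bt i h := heq ▸ hvs
  unfold locF
  rw [M.rep_succ_of_loop h heq]
  by_cases hv : M.rep i v = v
  · rw [if_pos hv, if_pos hv, M.low_succ_of_ne h hvs hvt]
  · rw [if_neg hv, if_neg hv]

include hj hjk in
/-- (i)–(iii) combined: the sum of the exponential factors of `G/G_i` over its localizations is at most
`e^{δ₀} K(δ_{i+1}, d) (L^{t′−t})^d` times that of `G/G_{i+1}`, where `t = j_{l(i+1)}` and `t′ = j_{i+1}(b_s)` is the new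
lowest index at the merged vertex. [cite: Balaban1983Higgs3, (2.16) p.428] -/
theorem sum_EXP_succ_le (box : V → Fin M.d → ℕ) :
    ∑ Θ ∈ M.Locs i k j box, M.EXP i j Θ
      ≤ Real.exp M.δ₀ * Cube.Kdec (M.δAt (i + 1)) M.d *
          ((M.L : ℝ) ^ (M.low (i + 1) (M.bs i h) j k - j ⟨i, h⟩)) ^ M.d *
        ∑ Θ ∈ M.Locs (i + 1) k j box, M.EXP (i + 1) j Θ := by
  set t := j ⟨i, h⟩ with htdef
  set t' := M.low (i + 1) (M.bs i h) j k with ht'def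
  have htt' : t ≤ t' := M.le_low_succ h hj hjk _
  have ht'k : t' ≤ k := M.low_le_k _ _ _ _
  have hK := Cube.Kdec_pos (M.δAt_pos (i + 1)) M.d_pos
  -- (i) pointwise
  have h1 : ∑ Θ ∈ M.Locs i k j box, M.EXP i j Θ
      ≤ Real.exp M.δ₀ * ∑ Θ ∈ M.Locs i k j box, (M.Ebig h j Θ)⁻¹ * M.EXP (i + 1) j Θ := by
    rw [Finset.mul_sum]
    refine Finset.sum_le_sum fun Θ hΘ => ?_
    have ht : (Θ (M.bt i h)).s = t := by rw [M.s_of_mem_Locs hΘ (M.rep_bt h), M.low_bt h hj hjk]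
    have := M.EXP_succ_le h hj ht
    linarith [this]
  refine h1.trans ?_
  rw [mul_assoc, mul_assoc]
  refine mul_le_mul_of_nonneg_left ?_ (Real.exp_pos _).le
  by_cases hne : M.bs i h ≠ M.bt i h
  · -- (ii) sum over Δ(b_t), then (iii) regroup Δ(b_s)
    refine (M.sum_bt_le h hj hjk hne box).trans ?_
    refine mul_le_mul_of_nonneg_left ?_ hK.le
    have hG : Function.update (M.locF i k j box) (M.bt i h) {M.unit k box (M.bt i h)} (M.bs i h)
        = Cube.desc M.L (M.unit k box (M.bs i h)) t := by
      rw [Function.update_of_ne hne]; unfold locF; rw [if_pos (M.rep_bs h), M.low_bs h hj hjk]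
    have := M.sum_regroup_le (j := j) (i + 1) box _ (M.bs i h) hG htt' ht'k
    unfold Locs; rw [M.locF_succ_of_ne h hne box]; exact this
  · -- the loop case: no sum over Δ(b_t) is needed (the leftover factor is 1)
    rw [not_not] at hne
    have h2 : ∑ Θ ∈ M.Locs i k j box, (M.Ebig h j Θ)⁻¹ * M.EXP (i + 1) j Θ
        = ∑ Θ ∈ M.Locs i k j box, M.EXP (i + 1) j Θ := by
      refine Finset.sum_congr rfl fun Θ _ => ?_
      unfold Ebig; rw [hne, Cube.distI_self]; simp
    rw [h2]
    have hG : M.locF i k j box (M.bs i h) = Cube.desc M.L (M.unit k box (M.bs i h)) t := by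
      unfold locF; rw [if_pos (M.rep_bs h), M.low_bs h hj hjk]
    have h3 := M.sum_regroup_le (j := j) (i + 1) box _ (M.bs i h) hG htt' ht'k
    have hK1 : 1 ≤ Cube.Kdec (M.δAt (i + 1)) M.d := by
      unfold Cube.Kdec
      have hc : 0 < M.δAt (i + 1) / M.d := div_pos (M.δAt_pos _) (by exact_mod_cast M.d_pos)
      have he : Real.exp (-(M.δAt (i + 1) / M.d)) < 1 := Real.exp_lt_one_iff.2 (by linarith)
      have h2le : (1 : ℝ) ≤ 2 / (1 - Real.exp (-(M.δAt (i + 1) / M.d))) := by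
        rw [le_div_iff₀ (by linarith)]; have := Real.exp_pos (-(M.δAt (i + 1) / M.d)); linarith
      exact one_le_mul_of_one_le_of_one_le (Real.one_le_exp (M.δAt_pos _).le) (one_le_pow₀ h2le)
    unfold Locs at h3 ⊢
    rw [M.locF_succ_of_loop h hne box]
    calc ∑ Θ ∈ Fintype.piFinset (M.locF i k j box), M.EXP (i + 1) j Θ
        ≤ ((M.L : ℝ) ^ (t' - t)) ^ M.d * ∑ w ∈ Fintype.piFinset (Function.update (M.locF i k j box) (M.bs i h)
            (Cube.desc M.L (M.unit k box (M.bs i h)) t')), M.EXP (i + 1) j w := h3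
      _ ≤ Cube.Kdec (M.δAt (i + 1)) M.d * (((M.L : ℝ) ^ (t' - t)) ^ M.d *
            ∑ w ∈ Fintype.piFinset (Function.update (M.locF i k j box) (M.bs i h)
              (Cube.desc M.L (M.unit k box (M.bs i h)) t')), M.EXP (i + 1) j w) := by
          refine le_mul_of_one_le_left ?_ hK1
          exact mul_nonneg (by positivity) (Finset.sum_nonneg fun w _ => (M.EXP_pos _ _ _).le)


/-! ## (iv) The remaining powers of `L^tη`: the step inequality (2.15′)/(2.16) -/

/-- The line powers split off the factor of l(i+1). [cite: Balaban1983Higgs3, (2.16) p.428] -/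
theorem LP_succ : M.LP i k j = M.sc k (j ⟨i, h⟩) ^ M.a ⟨i, h⟩ * M.LP (i + 1) k j := by
  unfold LP; rw [remLines_eq_insert h, Finset.prod_insert (not_mem_remLines_succ h)]

/-- The vertex factors of the unaffected vertices. [cite: Balaban1983Higgs3, (2.16) p.428] -/
noncomputable def VFrest (i k : ℕ) (h : i < m) (j : Fin m → ℕ) : ℝ :=
  ∏ b ∈ ((M.reps i).erase (M.bs i h)).erase (M.bt i h), M.sc k (M.low i b j k) ^ ((M.d : ℝ) + M.eAt i b)

/-- `VFrest > 0`. [cite: Balaban1983Higgs3, (2.16) p.428] -/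
theorem VFrest_pos : 0 < M.VFrest i k h j :=
  Finset.prod_pos fun _ _ => Real.rpow_pos_of_pos (M.sc_pos k _) _

include hj hjk in
/-- The vertex factors of `G/G_i`: those of `b_s`, `b_t` (scale `t`) and the rest. [cite: Balaban1983Higgs3, (2.16) p.428] -/
theorem VF_eq : M.VF i k j = M.sc k (j ⟨i, h⟩) ^ ((M.d : ℝ) + M.eAt i (M.bs i h))
    * (if M.bs i h = M.bt i h then 1 else M.sc k (j ⟨i, h⟩) ^ ((M.d : ℝ) + M.eAt i (M.bt i h)))
    * M.VFrest i k h j := by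
  unfold VF VFrest
  rw [← Finset.mul_prod_erase _ _ (M.bs_mem_reps h), M.low_bs h hj hjk]
  by_cases heq : M.bs i h = M.bt i h
  · rw [if_pos heq]
    have : ((M.reps i).erase (M.bs i h)).erase (M.bt i h) = (M.reps i).erase (M.bs i h) := by
      rw [← heq]; exact Finset.erase_eq_of_notMem (Finset.notMem_erase _ _)
    rw [this]; ring
  · rw [if_neg heq]
    have hbt : M.bt i h ∈ (M.reps i).erase (M.bs i h) := Finset.mem_erase.2 ⟨fun e => heq e.symm, M.bt_mem_reps h⟩
    rw [← Finset.mul_prod_erase _ _ hbt, M.low_bt h hj hjk]; ring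

/-- The vertex factors of `G/G_{i+1}`: the merged vertex at its new scale `t′` (no η-power) and the rest.
[cite: Balaban1983Higgs3, (2.16) p.428] -/
theorem VF_succ_eq : M.VF (i + 1) k j
    = M.sc k (M.low (i + 1) (M.bs i h) j k) ^ ((M.d : ℝ) + 0) * M.VFrest i k h j := by
  unfold VF VFrest
  have hrest : ∀ b ∈ ((M.reps i).erase (M.bs i h)).erase (M.bt i h),
      M.sc k (M.low (i + 1) b j k) ^ ((M.d : ℝ) + M.eAt (i + 1) b) = M.sc k (M.low i b j k) ^ ((M.d : ℝ) + M.eAt i b) := by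
    intro b hb
    have hb2 : b ≠ M.bt i h := (Finset.mem_erase.1 hb).1
    have hb1 : b ≠ M.bs i h := (Finset.mem_erase.1 (Finset.mem_erase.1 hb).2).1
    rw [M.low_succ_of_ne h hb1 hb2, M.eAt_succ_of_ne h hb1 hb2]
  by_cases heq : M.bs i h = M.bt i h
  · rw [M.reps_succ_of_loop h heq, ← Finset.mul_prod_erase _ _ (M.bs_mem_reps h), M.eAt_succ_bs h]
    have : ((M.reps i).erase (M.bs i h)).erase (M.bt i h) = (M.reps i).erase (M.bs i h) := by
      rw [← heq]; exact Finset.erase_eq_of_notMem (Finset.notMem_erase _ _)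
    rw [this] at hrest ⊢
    rw [Finset.prod_congr rfl hrest]
  · rw [M.reps_succ_of_ne h heq]
    have hbs : M.bs i h ∈ (M.reps i).erase (M.bt i h) := Finset.mem_erase.2 ⟨heq, M.bs_mem_reps h⟩
    rw [← Finset.mul_prod_erase _ _ hbs, M.eAt_succ_bs h, Finset.erase_right_comm, Finset.prod_congr rfl hrest]

include hj hjk in
/-- **(2.15′)/(2.16), the shrinking step** p. 427–428 [PDF 17–18], PROVED for a fixed scale assignment `j ∈ J(l̃)`
(monotone along the ordering, `j_l ≤ k − 1`): with `t = j_{l(i+1)}` the lowest index among the lines of `G/G_i`,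
`(L^tη)^{Σ_α D(G_i^{(α)})} Σ_{{Δ}} Ẽ_{δ_i}(G/G_i(j), {Δ}) ≤ e^{δ₀} K(δ_{i+1}, d) (L^tη)^{Σ_α D(G_{i+1}^{(α)})} Σ_{{Δ}}
Ẽ_{δ_{i+1}}(G/G_{i+1}(j), {Δ})` — *"the remaining powers of L^jη connected with the graph G₁ give us (L^jη)^{D(G₁)}"*.
The summation over `t` (*"Because D(G₁) > 0 we can make the summation over j"*) is performed in `B3Ineq215Proof`.
[cite: Balaban1983Higgs3, (2.16) p.428] -/
theorem step216 (box : V → Fin M.d → ℕ) :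
    M.sc k (j ⟨i, h⟩) ^ M.Dsum i * M.W i k j box
      ≤ Real.exp M.δ₀ * Cube.Kdec (M.δAt (i + 1)) M.d *
        (M.sc k (j ⟨i, h⟩) ^ M.Dsum (i + 1) * M.W (i + 1) k j box) := by
  have htt' : j ⟨i, h⟩ ≤ M.low (i + 1) (M.bs i h) j k := M.le_low_succ h hj hjk _
  have hx : 0 < M.sc k (j ⟨i, h⟩) := M.sc_pos k _
  have hy : 0 < M.sc k (M.low (i + 1) (M.bs i h) j k) := M.sc_pos k _
  have hS := M.sum_EXP_succ_le h hj hjk box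
  rw [← M.sc_div_sc k htt'] at hS
  have hO := M.VFrest_pos (i := i) (k := k) h (j := j)
  have hLP' := M.LP_pos (i + 1) k j
  have hS' : 0 ≤ ∑ Θ ∈ M.Locs (i + 1) k j box, M.EXP (i + 1) j Θ :=
    Finset.sum_nonneg fun Θ _ => (M.EXP_pos _ _ _).le
  have hK : 0 ≤ Real.exp M.δ₀ * Cube.Kdec (M.δAt (i + 1)) M.d :=
    mul_nonneg (Real.exp_pos _).le (Cube.Kdec_pos (M.δAt_pos (i + 1)) M.d_pos).le
  rw [M.W_eq, M.W_eq, M.VF_eq h hj hjk, M.VF_succ_eq h, M.LP_succ h, M.Dsum_succ h]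
  -- abbreviations for the algebra
  generalize hxdef : M.sc k (j ⟨i, h⟩) = x at *
  generalize hydef : M.sc k (M.low (i + 1) (M.bs i h) j k) = y at *
  generalize M.Dsum i = Di at *
  generalize M.a ⟨i, h⟩ = a at *
  generalize M.eAt i (M.bs i h) = es at *
  generalize M.eAt i (M.bt i h) = et at *
  generalize M.VFrest i k h j = O at *
  generalize M.LP (i + 1) k j = P at *
  generalize ∑ Θ ∈ M.Locs i k j box, M.EXP i j Θ = S at *
  generalize ∑ Θ ∈ M.Locs (i + 1) k j box, M.EXP (i + 1) j Θ = S' at *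
  generalize Real.exp M.δ₀ * Cube.Kdec (M.δAt (i + 1)) M.d = K at *
  -- exp/log form of the powers
  have elog : ∀ p : ℝ, x ^ p = Real.exp (Real.log x * p) := fun p => Real.rpow_def_of_pos hx p
  have elog' : ∀ p : ℝ, y ^ p = Real.exp (Real.log y * p) := fun p => Real.rpow_def_of_pos hy p
  have eratio : (y / x) ^ M.d = Real.exp ((Real.log y - Real.log x) * M.d) := by
    rw [← Real.rpow_natCast, Real.rpow_def_of_pos (div_pos hy hx), Real.log_div hy.ne' hx.ne']
  by_cases heq : M.bs i h = M.bt i h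
  · simp only [if_pos heq]
    have key : x ^ Di * x ^ ((M.d : ℝ) + es) * x ^ a * (y / x) ^ M.d = x ^ (Di + a + es + 0) * y ^ ((M.d : ℝ) + 0) := by
      rw [elog, elog, elog, elog, elog', eratio, ← Real.exp_add, ← Real.exp_add, ← Real.exp_add, ← Real.exp_add]
      congr 1; ring
    calc x ^ Di * (x ^ ((M.d : ℝ) + es) * 1 * O * (x ^ a * P) * S)
        = (x ^ Di * x ^ ((M.d : ℝ) + es) * x ^ a) * (O * P) * S := by ring
      _ ≤ (x ^ Di * x ^ ((M.d : ℝ) + es) * x ^ a) * (O * P) * (K * (y / x) ^ M.d * S') :=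
          mul_le_mul_of_nonneg_left hS (by positivity)
      _ = K * ((x ^ Di * x ^ ((M.d : ℝ) + es) * x ^ a * (y / x) ^ M.d) * (O * P) * S') := by ring
      _ = K * (x ^ (Di + a + es + 0) * (y ^ ((M.d : ℝ) + 0) * O * P * S')) := by rw [key]; ring
  · simp only [if_neg heq]
    have key : x ^ Di * x ^ ((M.d : ℝ) + es) * x ^ ((M.d : ℝ) + et) * x ^ a * (y / x) ^ M.d
        = x ^ (Di + a + es + ((M.d : ℝ) + et)) * y ^ ((M.d : ℝ) + 0) := by
      rw [elog, elog, elog, elog, elog, elog', eratio, ← Real.exp_add, ← Real.exp_add, ← Real.exp_add, ← Real.exp_add,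
        ← Real.exp_add]
      congr 1; ring
    calc x ^ Di * (x ^ ((M.d : ℝ) + es) * x ^ ((M.d : ℝ) + et) * O * (x ^ a * P) * S)
        = (x ^ Di * x ^ ((M.d : ℝ) + es) * x ^ ((M.d : ℝ) + et) * x ^ a) * (O * P) * S := by ring
      _ ≤ (x ^ Di * x ^ ((M.d : ℝ) + es) * x ^ ((M.d : ℝ) + et) * x ^ a) * (O * P) * (K * (y / x) ^ M.d * S') :=
          mul_le_mul_of_nonneg_left hS (by positivity)
      _ = K * ((x ^ Di * x ^ ((M.d : ℝ) + es) * x ^ ((M.d : ℝ) + et) * x ^ a * (y / x) ^ M.d) * (O * P) * S') := by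
          ring
      _ = K * (x ^ (Di + a + es + ((M.d : ℝ) + et)) * (y ^ ((M.d : ℝ) + 0) * O * P * S')) := by rw [key]; ring

end Step

end Model

end Literature.MathematicalPhysics.QuantumFieldTheory.Balaban1983to89.B3Ineq215
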